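import Literature.NumberTheory.EllipticCurves.RankinSymmSquareGL2Fields
import Literature.NumberTheory.Automorphic.RankinSelbergUniformBoundSL2
import HarnessLib

/-!
# The weak polynomial bound for `L_f(s) = Λ_f(s)/((s − 1)ζ(s)A(s))` on the Siegel disc

Topic `NumberTheory/EllipticCurves`; namespace `Literature.NumberTheory.EllipticCurves.ModularForms`.
A proofs-only complement (theorems only; no definition, no named fact, D-0026) to
`RankinSymmSquareGL2Fields` (`symmSqL N f`, the continued `ζ(2s)L(|a|², s+1)/ζ(s)` of a cusp form
`f ∈ S₂(Γ₀(N))`, built from Rankin's `Λ_f = rankinLambda N f`) and to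
`Automorphic/RankinSelbergUniformBoundSL2` (`exists_norm_J₀_le_uniform`: an ABSOLUTE `Q` with
`‖∫_𝒟 G E₀*(·, s)‖ ≤ Q (1 + a⁻¹)⁴ ∫_𝒟 G` for every `κ = 2` horocycle datum, `−1/2 ≤ Re s ≤ 7/2`).
It supplies the last member-side field of the Hoffstein–Lockhart datum
(`LFunctions/SiegelTheoremPairAbstract`, field `norm_L_le` in its WEAK form
`‖L i s‖ ≤ B Q_i^κ · max(1, Re L_i(1))`) for the symmetric-square family, for ALL levels `N` and
ALL `f ∈ S₂(Γ₀(N))`, with no functional equation, no newform theory and no Fourier expansion at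
cusps other than `∞`:

* `one_le_norm_moebiusWeightC` — `1 ≤ |J_s(N)|` for `Re s ≥ 1/2`
  (`J_s(N) = ∏_{p^k ∥ N} p^{2s(k−1)}(p^{2s} − 1)`, each factor of modulus `≥ 1`);
* `exists_norm_rankinJ₀_le` — `‖J_t(s)‖ ≤ Q (1 + Nt/(4π))⁴ V_t` for `−1/2 ≤ Re s ≤ 7/2`
  (`exists_norm_J₀_le_uniform` for the datum `G_f^{(t)}` of `CuspFormConjugatedTrace`);
* `exists_norm_rankinLambda_le` — **`‖Λ_f(s)‖ ≤ K N¹³ Re (f, f)`** on `|s − 2| ≤ 3/2`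
  (`V_t = Re (f, f)` for `t ∣ N`, `rankinMass_eq_re_peterssonProduct`; `|μ| ≤ 1`, `|tˢ| ≤ N⁴`,
  `#{t ∣ N} ≤ N`, `(1 + N²/(4π))⁴ ≤ 16 N⁸`);
* `gamma0Index_le_sq` — `[SL₂(ℤ) : Γ₀(N)] ≤ N²`, so `Re (f, f) = [SL₂(ℤ):Γ₀(N)] L_f(1)/(8π³) ≤ N² L_f(1)/(8π³)`
  (`symmSqL_one`);
* `exists_norm_symmSqL_le` — **`‖L_f(s)‖ ≤ B N¹⁵ max(1, Re L_f(1))` on `|s − 2| ≤ 1 + r`** for every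
  Siegel radius `r` (`exists_siegel_radius`: `ball 2 (1 + 2r) ⊆ {Re s > 0, (s−1)ζ(s) ≠ 0}`), with `B`
  depending only on `r` (the minimum of `|(s − 1)ζ(s)A(s)|` on the compact disc).

The self-referential shape `max(1, L_f(1))` is harmless in Siegel's argument (v3 of
`SiegelTheoremPairAbstract`: members with `L_i(1) > 1` satisfy the conclusion trivially) and is what
replaces the convexity bound of Hoffstein–Lockhart (which presupposes the functional equation of
`L(s, Sym² f)`, Gelbart–Jacquet / Shimura) in this tree.

## References

* J. Hoffstein, P. Lockhart, *Coefficients of Maass forms and the Siegel zero*, Ann. of Math. 140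
  (1994), Thm. 0.1 and §1 (the scheme; there via convexity). [cite: HoffsteinLockhart1994, Thm. 0.1]
* R. A. Rankin, Proc. Cambridge Philos. Soc. 35 (1939), Thm. 3, §4.4. [cite: Rankin1939, Thm. 3]
* H. Iwaniec, *Spectral methods of automorphic forms*, GSM 53 (2002), §3.2, §7.1 (`E(z, s) ≪ y^σ`
  on `𝒟`; unfolding). [cite: Iwaniec2002, §7.1]

## Mathlib / tree search

Tree: `exists_norm_J₀_le_uniform` (`Automorphic/RankinSelbergUniformBoundSL2`),
`conjTrace_horocycle_datum`, `exists_conjTrace_le` (`CuspFormConjugatedTrace`), `rankinJ₀`,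
`rankinMass`, `rankinLambda`, `moebiusWeightC_eq_prod`, `rankinMass_eq_re_peterssonProduct`
(`Gamma0RankinSelbergContinuation`), `symmSqL`, `rankinArch_ne_zero`, `differentiableOn_rankinArch`,
`symmSqL_one`, `exists_siegel_radius` (`RankinSymmSquareGL2Fields`), `gamma0Index`
(`ModularCurve`). Mathlib: `differentiable_riemannZeta₁`, `IsCompact.exists_isMinOn`,
`ArithmeticFunction.abs_moebius_le_one`, `Nat.card_divisors_le_self`, `Complex.norm_natCast_cpow_of_pos`.
-/

noncomputable section

open scoped Real Topology MatrixGroups Modular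
open Set Filter Metric Complex CongruenceSubgroup MeasureTheory ArithmeticFunction
open scoped ArithmeticFunction.Moebius
open Literature.NumberTheory.Automorphic

namespace Literature.NumberTheory.EllipticCurves.ModularForms

/-! ### `|J_s(N)| ≥ 1` for `Re s ≥ 1/2` -/

section Moebius

/-- Each Euler factor of `J_s(N)` has modulus at least `1` when `Re s ≥ 1/2`:
`|(p^{2s})^k − (p^{2s})^{k−1}| = |p^{2s}|^{k−1} |p^{2s} − 1| ≥ 1` (`|p^{2s}| = p^{2σ} ≥ p ≥ 2`, `k ≥ 1`).
[folklore] -/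
theorem one_le_norm_moebius_factor {p k : ℕ} (hp : p.Prime) (hk : 1 ≤ k) {s : ℂ} (hs : 1 / 2 ≤ s.re) :
    1 ≤ ‖((p : ℂ) ^ (2 * s)) ^ k - ((p : ℂ) ^ (2 * s)) ^ (k - 1)‖ := by
  set x : ℂ := (p : ℂ) ^ (2 * s) with hx
  have hp0 : 0 < p := hp.pos
  have hp2 : (2 : ℝ) ≤ p := by exact_mod_cast hp.two_le
  have hxnorm : ‖x‖ = (p : ℝ) ^ (2 * s.re) := by
    rw [hx, Complex.norm_natCast_cpow_of_pos hp0]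
    simp
  have hx2 : (2 : ℝ) ≤ ‖x‖ := by
    rw [hxnorm]
    calc (2 : ℝ) ≤ p := hp2
      _ = (p : ℝ) ^ (1 : ℝ) := (Real.rpow_one _).symm
      _ ≤ (p : ℝ) ^ (2 * s.re) := Real.rpow_le_rpow_of_exponent_le (by linarith) (by linarith)
  have hfac : x ^ k - x ^ (k - 1) = x ^ (k - 1) * (x - 1) := by
    obtain ⟨j, rfl⟩ : ∃ j, k = j + 1 := ⟨k - 1, by omega⟩
    simp [pow_succ]; ring
  rw [hfac, norm_mul, norm_pow]
  have h1 : 1 ≤ ‖x‖ ^ (k - 1) := one_le_pow₀ (by linarith)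
  have h2 : 1 ≤ ‖x - 1‖ := by
    have := norm_sub_norm_le x 1
    rw [norm_one] at this
    linarith
  nlinarith

/-- **`1 ≤ |J_s(N)|` for `Re s ≥ 1/2`** (`N ≥ 1`): `J_s(N) = ∏_{p^k ∥ N} ((p^{2s})^k − (p^{2s})^{k−1})`
(`moebiusWeightC_eq_prod`) and each factor has modulus `≥ 1`. [folklore] -/
theorem one_le_norm_moebiusWeightC {N : ℕ} (hN : N ≠ 0) {s : ℂ} (hs : 1 / 2 ≤ s.re) :
    1 ≤ ‖moebiusWeightC N s‖ := by
  rw [moebiusWeightC_eq_prod hN, moebiusWeightProdC, Finsupp.prod, norm_prod]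
  refine Finset.prod_induction _ (fun r : ℝ ↦ 1 ≤ r) (fun a b ha hb ↦ one_le_mul_of_one_le_of_one_le ha hb)
    le_rfl fun p hp ↦ ?_
  rw [Nat.support_factorization] at hp
  exact one_le_norm_moebius_factor (Nat.prime_of_mem_primeFactors hp)
    (Nat.Prime.factorization_pos_of_dvd (Nat.prime_of_mem_primeFactors hp) hN
      (Nat.dvd_of_mem_primeFactors hp)) hs

end Moebius

/-! ### The uniform bound for `J_t` and for `Λ_f` -/

section Lambda

/-- **`‖J_t(s)‖ ≤ Q (1 + Nt/(4π))⁴ V_t`** for `−1/2 ≤ Re s ≤ 7/2`, with the absolute `Q` of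
`exists_norm_J₀_le_uniform` (the datum `G_f^{(t)}` has `a = 4π/(Nt)`, `κ = 2`).
[cite: Rankin1939, §4.4] -/
theorem exists_norm_rankinJ₀_le :
    ∃ Q : ℝ, 0 < Q ∧ ∀ (N : ℕ) [NeZero N] (t : ℕ) [NeZero t] (f : CuspForm (Gamma0 N) 2) (s : ℂ),
      -1 / 2 ≤ s.re → s.re ≤ 7 / 2 →
        ‖rankinJ₀ N t f s‖ ≤ Q * (1 + ((N * t : ℕ) : ℝ) / (4 * π)) ^ 4 * rankinMass N t f := by
  obtain ⟨Q, hQ, h⟩ := exists_norm_J₀_le_uniform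
  refine ⟨Q, hQ, fun N _ t _ f s hsa hsb ↦ ?_⟩
  obtain ⟨B, -, hB⟩ := exists_conjTrace_le (N := N) (t := t) f
  obtain ⟨hGc, hGinv, hG0, hGB, hC, hC0, ha, -, hsum, -, hm⟩ := conjTrace_horocycle_datum f hB
  have key := h hGc hGinv hG0 hGB hC hC0 ha hsum hm hsa hsb
  have hinv : (4 * Real.pi / ((N * t : ℕ) : ℝ))⁻¹ = ((N * t : ℕ) : ℝ) / (4 * π) := by
    rw [inv_div]
  rw [hinv] at key
  exact key

/-- `Re (f, f) ≥ 0` (it is the mass `V_N = ∫_𝒟 G_f^{(N)} ≥ 0`). [folklore] -/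
theorem re_peterssonProduct_self_nonneg {N : ℕ} [NeZero N] (f : CuspForm (Gamma0 N) 2) :
    0 ≤ (peterssonProduct (Gamma0 N) 2 f f).re := by
  rw [← rankinMass_eq_re_peterssonProduct (t := N) dvd_rfl f, rankinMass]
  exact setIntegral_nonneg ModularGroup.isClosed_fd.measurableSet fun w _ ↦ conjTrace_nonneg f w

/-- **`‖Λ_f(s)‖ ≤ K N¹³ Re (f, f)` on the disc `|s − 2| ≤ 3/2`**, with an absolute `K > 0`, for every
level `N ≥ 1` and every `f ∈ S₂(Γ₀(N))`: in
`Λ_f = J_s(N)⁻¹ Σ_{t∣N} μ(N/t) tˢ ((s−1)J_t(s) − V_t((s−1)/(2s) − 1/2))` one has `|J_s(N)| ≥ 1`,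
`|μ| ≤ 1`, `|tˢ| ≤ N⁴`, `|s − 1| ≤ 5/2`, `|(s−1)/(2s) − 1/2| = 1/(2|s|) ≤ 1`, `V_t = Re (f,f)`,
`‖J_t(s)‖ ≤ Q(1 + N²/(4π))⁴ V_t ≤ 16 Q N⁸ Re (f,f)` and at most `N` divisors.
[cite: Rankin1939, Thm. 3] [cite: HoffsteinLockhart1994, Thm. 0.1 (scheme)] -/
theorem exists_norm_rankinLambda_le :
    ∃ K : ℝ, 0 < K ∧ ∀ (N : ℕ) [NeZero N] (f : CuspForm (Gamma0 N) 2), ∀ s ∈ closedBall (2 : ℂ) (3 / 2),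
      ‖rankinLambda N f s‖ ≤ K * (N : ℝ) ^ 13 * (peterssonProduct (Gamma0 N) 2 f f).re := by
  obtain ⟨Q, hQ, hJ⟩ := exists_norm_rankinJ₀_le
  refine ⟨40 * Q + 1, by positivity, fun N _ f s hs ↦ ?_⟩
  have hN0 : N ≠ 0 := NeZero.ne N
  have hN1 : (1 : ℝ) ≤ N := by exact_mod_cast Nat.one_le_iff_ne_zero.mpr hN0
  set V : ℝ := (peterssonProduct (Gamma0 N) 2 f f).re with hV
  have hV0 : 0 ≤ V := re_peterssonProduct_self_nonneg f
  -- the geometry of the disc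
  have hs' : ‖s - 2‖ ≤ 3 / 2 := mem_closedBall_iff_norm.mp hs
  have hre : |s.re - 2| ≤ 3 / 2 := by
    have := abs_re_le_norm (s - 2); simp at this; linarith
  have hsa : -1 / 2 ≤ s.re := by have := (abs_le.mp hre).1; linarith
  have hsa' : 1 / 2 ≤ s.re := by have := (abs_le.mp hre).1; linarith
  have hsb : s.re ≤ 7 / 2 := by have := (abs_le.mp hre).2; linarith
  have hs1 : ‖s - 1‖ ≤ 5 / 2 := by
    calc ‖s - 1‖ = ‖(s - 2) + 1‖ := by ring_nf
      _ ≤ ‖s - 2‖ + ‖(1 : ℂ)‖ := norm_add_le _ _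
      _ ≤ 5 / 2 := by rw [norm_one]; linarith
  have hsnorm : 1 / 2 ≤ ‖s‖ := hsa'.trans (re_le_norm s)
  have hs0 : s ≠ 0 := fun h ↦ by rw [h, norm_zero] at hsnorm; linarith
  -- `|J_s(N)|⁻¹ ≤ 1`
  have hJinv : ‖(moebiusWeightC N s)⁻¹‖ ≤ 1 := by
    rw [norm_inv]
    exact inv_le_one_of_one_le₀ (one_le_norm_moebiusWeightC hN0 hsa')
  -- the bound for each term of the sum
  have hterm : ∀ tt ∈ N.divisors.attach,
      ‖(μ (N / tt.1) : ℂ) * (tt.1 : ℂ) ^ s *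
        ((s - 1) * rankinJ₀ N tt.1 f s - (rankinMass N tt.1 f : ℂ) * ((s - 1) / (2 * s) - 1 / 2))‖ ≤
      (40 * Q + 1) * (N : ℝ) ^ 12 * V := by
    intro tt _
    have htN : tt.1 ∣ N := Nat.dvd_of_mem_divisors tt.2
    have ht0 : 0 < tt.1 := Nat.pos_of_mem_divisors tt.2
    haveI : NeZero tt.1 := ⟨ht0.ne'⟩
    have htle : (tt.1 : ℝ) ≤ N := by exact_mod_cast Nat.divisor_le tt.2
    have ht1 : (1 : ℝ) ≤ tt.1 := by exact_mod_cast ht0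
    have hmass : rankinMass N tt.1 f = V := rankinMass_eq_re_peterssonProduct htN f
    -- `|μ| ≤ 1`
    have hμ : ‖(μ (N / tt.1) : ℂ)‖ ≤ 1 := by
      rw [Complex.norm_intCast]
      exact_mod_cast abs_moebius_le_one
    -- `|t^s| ≤ N^4`
    have hts : ‖(tt.1 : ℂ) ^ s‖ ≤ (N : ℝ) ^ 4 := by
      rw [Complex.norm_natCast_cpow_of_pos ht0]
      calc (tt.1 : ℝ) ^ s.re ≤ (tt.1 : ℝ) ^ (4 : ℝ) :=
            Real.rpow_le_rpow_of_exponent_le ht1 (by linarith)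
        _ = (tt.1 : ℝ) ^ (4 : ℕ) := by rw [← Real.rpow_natCast]; norm_num
        _ ≤ (N : ℝ) ^ 4 := by gcongr
    -- `‖J_t(s)‖ ≤ 16 Q N^8 V`
    have hJt : ‖rankinJ₀ N tt.1 f s‖ ≤ 16 * Q * (N : ℝ) ^ 8 * V := by
      have h := hJ N tt.1 f s hsa hsb
      rw [hmass] at h
      refine h.trans ?_
      have hNt : ((N * tt.1 : ℕ) : ℝ) ≤ (N : ℝ) ^ 2 := by
        push_cast; nlinarith
      have hπ4 : (1 : ℝ) ≤ 4 * π := by linarith [Real.pi_gt_three]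
      have hfrac : ((N * tt.1 : ℕ) : ℝ) / (4 * π) ≤ (N : ℝ) ^ 2 := by
        rw [div_le_iff₀ (by positivity)]
        calc ((N * tt.1 : ℕ) : ℝ) ≤ (N : ℝ) ^ 2 := hNt
          _ = (N : ℝ) ^ 2 * 1 := (mul_one _).symm
          _ ≤ (N : ℝ) ^ 2 * (4 * π) := by gcongr
      have hN2 : (1 : ℝ) ≤ (N : ℝ) ^ 2 := one_le_pow₀ hN1
      have hbase : 1 + ((N * tt.1 : ℕ) : ℝ) / (4 * π) ≤ 2 * (N : ℝ) ^ 2 := by linarith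
      have hbase0 : 0 ≤ 1 + ((N * tt.1 : ℕ) : ℝ) / (4 * π) := by positivity
      calc Q * (1 + ((N * tt.1 : ℕ) : ℝ) / (4 * π)) ^ 4 * V ≤ Q * (2 * (N : ℝ) ^ 2) ^ 4 * V := by
            gcongr
        _ = 16 * Q * (N : ℝ) ^ 8 * V := by ring
    -- `|(s-1)/(2s) - 1/2| ≤ 1`
    have hhalf : ‖(s - 1) / (2 * s) - 1 / 2‖ ≤ 1 := by
      have e : (s - 1) / (2 * s) - 1 / 2 = -(1 / (2 * s)) := by field_simp; ring
      rw [e, norm_neg, norm_div, norm_one, norm_mul, Complex.norm_two]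
      rw [div_le_one (by positivity)]
      linarith
    have hmassn : ‖(rankinMass N tt.1 f : ℂ)‖ = V := by
      rw [Complex.norm_real, hmass, Real.norm_of_nonneg hV0]
    -- assemble
    calc ‖(μ (N / tt.1) : ℂ) * (tt.1 : ℂ) ^ s *
          ((s - 1) * rankinJ₀ N tt.1 f s - (rankinMass N tt.1 f : ℂ) * ((s - 1) / (2 * s) - 1 / 2))‖
        ≤ ‖(μ (N / tt.1) : ℂ)‖ * ‖(tt.1 : ℂ) ^ s‖ *
          (‖s - 1‖ * ‖rankinJ₀ N tt.1 f s‖ + ‖(rankinMass N tt.1 f : ℂ)‖ * ‖(s - 1) / (2 * s) - 1 / 2‖) := by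
          rw [norm_mul, norm_mul]
          gcongr
          exact (norm_sub_le _ _).trans (by rw [norm_mul, norm_mul])
      _ ≤ 1 * (N : ℝ) ^ 4 * (5 / 2 * (16 * Q * (N : ℝ) ^ 8 * V) + V * 1) := by
          rw [hmassn]
          gcongr
      _ ≤ (40 * Q + 1) * (N : ℝ) ^ 12 * V := by
          have hN8 : (1 : ℝ) ≤ (N : ℝ) ^ 8 := one_le_pow₀ hN1
          have : V * 1 ≤ (N : ℝ) ^ 8 * V := by nlinarith
          nlinarith [pow_nonneg (by positivity : (0 : ℝ) ≤ N) 4, mul_nonneg hQ.le hV0]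
  -- sum over the divisors
  have hcard : (N.divisors.attach.card : ℝ) ≤ N := by
    rw [Finset.card_attach]; exact_mod_cast Nat.card_divisors_le_self N
  rw [rankinLambda, norm_mul]
  calc ‖(moebiusWeightC N s)⁻¹‖ * ‖∑ tt ∈ N.divisors.attach, (μ (N / tt.1) : ℂ) * (tt.1 : ℂ) ^ s *
        ((s - 1) * rankinJ₀ N tt.1 f s - (rankinMass N tt.1 f : ℂ) * ((s - 1) / (2 * s) - 1 / 2))‖
      ≤ 1 * ∑ tt ∈ N.divisors.attach, ‖(μ (N / tt.1) : ℂ) * (tt.1 : ℂ) ^ s *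
        ((s - 1) * rankinJ₀ N tt.1 f s - (rankinMass N tt.1 f : ℂ) * ((s - 1) / (2 * s) - 1 / 2))‖ :=
        mul_le_mul hJinv (norm_sum_le _ _) (norm_nonneg _) zero_le_one
    _ ≤ 1 * (N.divisors.attach.card • ((40 * Q + 1) * (N : ℝ) ^ 12 * V)) :=
        mul_le_mul_of_nonneg_left (Finset.sum_le_card_nsmul _ _ _ hterm) zero_le_one
    _ = N.divisors.attach.card * ((40 * Q + 1) * (N : ℝ) ^ 12 * V) := by rw [one_mul, nsmul_eq_mul]
    _ ≤ N * ((40 * Q + 1) * (N : ℝ) ^ 12 * V) := by gcongr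
    _ = (40 * Q + 1) * (N : ℝ) ^ 13 * V := by ring

end Lambda

/-! ### `[SL₂(ℤ) : Γ₀(N)] ≤ N²` and the bound for `L_f` -/

section SymmSq

/-- **`[SL₂(ℤ) : Γ₀(N)] ≤ N²`**: `∏_{p^e ∥ N} p^{e−1}(p + 1) ≤ ∏ p^{2e}` (`p + 1 ≤ p²`, `e ≥ 1`).
[folklore] -/
theorem gamma0Index_le_sq {N : ℕ} (hN : N ≠ 0) : gamma0Index N ≤ N ^ 2 := by
  have hN2 : N ^ 2 = N.factorization.prod fun p e ↦ p ^ (2 * e) := by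
    conv_lhs => rw [← Nat.prod_factorization_pow_eq_self hN]
    rw [Finsupp.prod, Finsupp.prod, ← Finset.prod_pow]
    refine Finset.prod_congr rfl fun p _ ↦ ?_
    ring
  rw [gamma0Index, hN2, Finsupp.prod, Finsupp.prod]
  refine Finset.prod_le_prod' fun p hp ↦ ?_
  rw [Nat.support_factorization] at hp
  have hpp := Nat.prime_of_mem_primeFactors hp
  have he : 1 ≤ N.factorization p := hpp.factorization_pos_of_dvd hN (Nat.dvd_of_mem_primeFactors hp)
  have hp2 : 2 ≤ p := hpp.two_le
  set e := N.factorization p with he'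
  calc p ^ (e - 1) * (p + 1) ≤ p ^ (e - 1) * p ^ 2 := by
        apply Nat.mul_le_mul_left; nlinarith
    _ = p ^ (e + 1) := by rw [← pow_add]; congr 1; omega
    _ ≤ p ^ (2 * e) := Nat.pow_le_pow_right hpp.pos (by omega)

/-- `Re (f, f) ≤ N² Re L_f(1)/(8π³)` (`L_f(1) = 8π³ Re (f,f)/[SL₂(ℤ):Γ₀(N)]`, `symmSqL_one`, and
`[SL₂(ℤ):Γ₀(N)] ≤ N²`). [folklore] -/
theorem re_peterssonProduct_le_sq_mul_symmSqL_one {N : ℕ} [NeZero N] (f : CuspForm (Gamma0 N) 2) :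
    (peterssonProduct (Gamma0 N) 2 f f).re ≤
      (N : ℝ) ^ 2 * (symmSqL N f 1).re / (8 * π ^ 3) := by
  have hN0 : N ≠ 0 := NeZero.ne N
  have hidx0 : (0 : ℝ) < gamma0Index N := by exact_mod_cast gamma0Index_pos N
  have hidx : (gamma0Index N : ℝ) ≤ (N : ℝ) ^ 2 := by exact_mod_cast gamma0Index_le_sq hN0
  have hV0 := re_peterssonProduct_self_nonneg f
  set V := (peterssonProduct (Gamma0 N) 2 f f).re
  have h1 : (symmSqL N f 1).re = 8 * π ^ 3 * V / gamma0Index N := by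
    rw [symmSqL_one, Complex.ofReal_re]
  rw [h1, le_div_iff₀ (by positivity)]
  have e : (N : ℝ) ^ 2 * (8 * π ^ 3 * V / gamma0Index N) = (N : ℝ) ^ 2 / gamma0Index N * (V * (8 * π ^ 3)) := by
    field_simp
  rw [e]
  have hq : 1 ≤ (N : ℝ) ^ 2 / gamma0Index N := by rwa [one_le_div hidx0]
  exact le_mul_of_one_le_left (by positivity) hq

/-- **The weak polynomial bound for `L_f` on the Siegel disc**: for every radius `r ∈ (0, 1/4]` with
`ball 2 (1 + 2r) ⊆ {Re s > 0, (s − 1)ζ(s) ≠ 0}` (`exists_siegel_radius`) there is `B > 0` (depending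
only on `r`) such that for every level `N ≥ 1`, every `f ∈ S₂(Γ₀(N))` and every `s` with
`|s − 2| ≤ 1 + r`: `‖L_f(s)‖ ≤ B N¹⁵ max(1, Re L_f(1))`. Proof: `L_f = Λ_f/((s−1)ζ(s)A(s))`, the
denominator is continuous and zero-free on the compact disc (minimum `m > 0`),
`‖Λ_f(s)‖ ≤ K N¹³ Re (f,f)` and `Re (f,f) ≤ N² Re L_f(1)/(8π³)`. This is the field `norm_L_le` of
`SiegelPairFamilyData` (weak form, v3) for the symmetric-square family, obtained without the
functional equation of `L(s, Sym² f)`. [cite: HoffsteinLockhart1994, Thm. 0.1 (scheme)] [cite: Rankin1939, Thm. 3] -/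
theorem exists_norm_symmSqL_le {r : ℝ} (hr0 : 0 < r) (hr4 : r ≤ 1 / 4)
    (hr : ∀ s ∈ ball (2 : ℂ) (1 + 2 * r), 0 < s.re ∧ riemannZeta₁ s ≠ 0) :
    ∃ B : ℝ, 0 < B ∧ ∀ (N : ℕ) [NeZero N] (f : CuspForm (Gamma0 N) 2), ∀ s ∈ closedBall (2 : ℂ) (1 + r),
      ‖symmSqL N f s‖ ≤ B * (N : ℝ) ^ 15 * max 1 (symmSqL N f 1).re := by
  obtain ⟨K, hK, hΛ⟩ := exists_norm_rankinLambda_le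
  -- the denominator `(s-1)ζ(s)A(s)` on the compact disc
  set S : Set ℂ := closedBall (2 : ℂ) (1 + r) with hS
  have hSsub : S ⊆ ball (2 : ℂ) (1 + 2 * r) := closedBall_subset_ball (by linarith)
  have hScpt : IsCompact S := isCompact_closedBall _ _
  have hSne : S.Nonempty := ⟨2, mem_closedBall_self (by linarith)⟩
  set g : ℂ → ℂ := fun s ↦ riemannZeta₁ s * rankinArch s with hg
  have hgc : ContinuousOn g S := by
    refine (differentiable_riemannZeta₁.continuous.continuousOn).mul ?_
    exact differentiableOn_rankinArch.continuousOn.mono fun s hs ↦ (hr s (hSsub hs)).1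
  have hgne : ∀ s ∈ S, g s ≠ 0 := fun s hs ↦
    mul_ne_zero (hr s (hSsub hs)).2 (rankinArch_ne_zero (hr s (hSsub hs)).1)
  obtain ⟨s₀, hs₀, hmin⟩ := hScpt.exists_isMinOn hSne (continuous_norm.comp_continuousOn hgc)
  set m : ℝ := ‖g s₀‖ with hm
  have hm0 : 0 < m := norm_pos_iff.mpr (hgne s₀ hs₀)
  have hmle : ∀ s ∈ S, m ≤ ‖g s‖ := fun s hs ↦ hmin hs
  refine ⟨K / (8 * π ^ 3 * m), by positivity, fun N _ f s hs ↦ ?_⟩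
  have hN0 : N ≠ 0 := NeZero.ne N
  have hN1 : (1 : ℝ) ≤ N := by exact_mod_cast Nat.one_le_iff_ne_zero.mpr hN0
  have hs32 : s ∈ closedBall (2 : ℂ) (3 / 2) := closedBall_subset_closedBall (by linarith) hs
  have h1 := hΛ N f s hs32
  have h2 := re_peterssonProduct_le_sq_mul_symmSqL_one f
  have hV0 := re_peterssonProduct_self_nonneg f
  have hgs : m ≤ ‖g s‖ := hmle s hs
  have hgs0 : 0 < ‖g s‖ := hm0.trans_le hgs
  have hL1 : (symmSqL N f 1).re ≤ max 1 (symmSqL N f 1).re := le_max_right _ _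
  have hmax0 : 0 ≤ max 1 (symmSqL N f 1).re := zero_le_one.trans (le_max_left _ _)
  rw [symmSqL, norm_div, div_le_iff₀ hgs0]
  calc ‖rankinLambda N f s‖ ≤ K * (N : ℝ) ^ 13 * (peterssonProduct (Gamma0 N) 2 f f).re := h1
    _ ≤ K * (N : ℝ) ^ 13 * ((N : ℝ) ^ 2 * (symmSqL N f 1).re / (8 * π ^ 3)) := by gcongr
    _ ≤ K * (N : ℝ) ^ 13 * ((N : ℝ) ^ 2 * max 1 (symmSqL N f 1).re / (8 * π ^ 3)) := by gcongr
    _ = K / (8 * π ^ 3 * m) * (N : ℝ) ^ 15 * max 1 (symmSqL N f 1).re * m := by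
        field_simp
    _ ≤ K / (8 * π ^ 3 * m) * (N : ℝ) ^ 15 * max 1 (symmSqL N f 1).re * ‖g s‖ := by
        gcongr

end SymmSq

end Literature.NumberTheory.EllipticCurves.ModularForms

end
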